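import Summits.RiemannHypothesis.RiemannHypothesis.Theorems.TiltedLandingLaw421R3K2NoZFloor

/-! # L1 — pair-exact location of the child (W-08 ⟨stmt 33346⟩ RUNG-P socket 3′, architecture (c); C2 desk rh-idea-2 g54/g55; v3 = v2 minus `prod_le3`)
v3 (g55, (CA888)): the helper `prod_le3` (twin of `Literature…Balaban1983to89.Beta.CrossTermBounds.mul_three_le`, `dedup.landed`) is DELETED and inlined
as a local `have` in `term3`/`kernel_raw`, and the helper `norm_sub_norm_le_norm_add` (twin of Mathlib `norm_sub_le_norm_add`, desk `exact?` screen) is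
DELETED and cited by name; every other byte, incl. the statement block 8ef3a83acd685716 and all 30 remaining theorem statements, is v2 f9716b80b4d2f3de.
Proves `PairExactLocationQ 18 (9/5) 2` = the WANTED v3 statement (`pub/ideators/rh-idea-2/g53/cert/scratch/PairExactLocation-WANTED-v3-C2-g53.lean`
d6a9be5c8cd62e0c, ns `RhW08.C2g53.Wanted`; its `def` body is re-declared VERBATIM here, block sha16 8ef3a83acd685716).  A pure inequality over `ℂ`:
no `f`, no holomorphy, no Rouché, no count (`u` is given).  SUPPORT; RH is not proved and nothing here bears on it; ⟨33346⟩/⟨33347⟩ OPEN.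
PROOF.  `d = u − w ≠ 0`; poles `a ∈ {w̄, p, p̄}`, `δ_a = w − a`, `u − a = δ_a + d`; `E = d⁻¹ + Σ_a (u − a)⁻¹ + R` (`‖E‖ ≤ M‖d‖/Im w²` is the
implicit clause); `T = Σ_a d²/(δ_a²(δ_a + d))` (exact Taylor remainders of `(δ_a + d)⁻¹`, `inv_add_eq`); `X = Q·d + T − E`.  Then `K + X = −d⁻¹`
(`K_add_X`) and the KEY IDENTITY `d + K⁻¹ + Q·K⁻³ = −(X − Q d)·d/K + Q·X·(2K + X)·d²/K³` (`key_identity`).  Norms scale by `κ = ‖K‖`: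
`L = Im w·κ ≥ 18`, `a = ‖w − p‖κ ≥ 9`, `b = ‖w − p̄‖κ ≥ max (a, L + 18)`, `t = ‖d‖κ ≤ 3`;
`‖Q‖ ≤ κ²·qh`, `‖T‖ ≤ κ·Th`, `‖E‖ ≤ κ·M t/L²`,
`‖X‖ ≤ κ·Xh` (§1).  `κ ≤ 1/‖d‖ + ‖X‖` gives `t ≤ 1 + t·Xh(t)`; the bootstrap `boot` (`Xh ≤ 1/6 ⇒ t ≤ 6/5`, `Xh ≤ 1/16 ⇒ t ≤ 16/15`) feeds the
dimensionless KERNEL `L²·[t(Th + M t/L²) + qh·Xh·(2 + Xh)·t²] ≤ (9/5)M + 2/L + 2L²/a³` (`kernel`, proved with slack `1.91/L + 1.92L²/a³ + 1.18M`),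
and `(2/L + 2L²/a³)/(L²κ) = 2ρ/(Im w‖K‖)²/‖K‖`, `ρ = (1 + (Im w/‖w−p‖)³)/(Im w‖K‖)` (`kernel_raw`). -/

namespace RhW08.PairExactLocation

open Complex
open scoped ComplexConjugate

/-- VERBATIM re-declaration of `RhW08.C2g53.Wanted.PairExactLocationQ` (WANTED v3): **pair-exact location of the child.**  Base state `w`,
partner `p` (separated `min (Im w) (Im p) ≤ 2‖w − p‖`), rest field `R`, `K = P(w) + R`, `Q = P′(w)`, floor `lam0 ≤ min (Im w) (Im p)·‖K‖`, cofactor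
mass `0 ≤ M ≤ 10`; a point `u ≠ w` of the count disc `‖u − w‖ ≤ 3/‖K‖` satisfying the implicit pair-exact clause lies within
`(c₁ M + c₂ ρ)/(Im w‖K‖)²/‖K‖` of the pair-corrected Newton point `w − K⁻¹ − Q K⁻³`, `ρ = (1 + (Im w/‖w − p‖)³)/(Im w‖K‖)`. -/
def PairExactLocationQ (lam0 c₁ c₂ : ℝ) : Prop :=
  ∀ (u w p R K Q : ℂ) (M : ℝ),
    0 < w.im → 0 < p.im → min w.im p.im ≤ 2 * ‖w - p‖ →
    K = (w - conj w)⁻¹ + (w - p)⁻¹ + (w - conj p)⁻¹ + R →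
    Q = -((w - conj w)⁻¹ ^ 2 + (w - p)⁻¹ ^ 2 + (w - conj p)⁻¹ ^ 2) →
    lam0 ≤ min w.im p.im * ‖K‖ → 0 ≤ M → M ≤ 10 →
    u ≠ w → ‖u - w‖ ≤ 3 / ‖K‖ →
    ‖(u - w)⁻¹ + (u - conj w)⁻¹ + (u - p)⁻¹ + (u - conj p)⁻¹ + R‖ ≤ M * ‖u - w‖ / w.im ^ 2 →
    ‖u - (w - K⁻¹ - Q * K⁻¹ ^ 3)‖ ≤
      (c₁ * M + c₂ * ((1 + (w.im / ‖w - p‖) ^ 3) / (w.im * ‖K‖))) / (w.im * ‖K‖) ^ 2 / ‖K‖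
/-- VERBATIM re-declaration of the WANTED target instance (director (CA844)/(CA856)(2): floor 18, `c₁ = 9/5`, residue constant `c₂ = 2`). -/
def PairExactLocationTarget : Prop := PairExactLocationQ 18 (9 / 5) 2
/-- (definitional) monotonicity in the floor and in both constants. -/
theorem pairExactLocationQ_mono {lam0 lam0' c₁ c₁' c₂ c₂' : ℝ} (h0 : lam0 ≤ lam0') (h1 : c₁ ≤ c₁') (h2 : c₂ ≤ c₂')
    (hP : PairExactLocationQ lam0 c₁ c₂) : PairExactLocationQ lam0' c₁' c₂' := by
  intro u w p R K Q M hw hp hsep hK hQ hfl hM0 hM10 hu hdisc himp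
  have hρ : 0 ≤ (1 + (w.im / ‖w - p‖) ^ 3) / (w.im * ‖K‖) := by positivity
  refine (hP u w p R K Q M hw hp hsep hK hQ (h0.trans hfl) hM0 hM10 hu hdisc himp).trans ?_
  gcongr

/-! ## §1  The dimensionless kernel (real inequalities in `L = Im w·κ`, `a = ‖w−p‖κ`, `b = ‖w−p̄‖κ`, `t = ‖u−w‖κ`, `M`) -/
/-- `qh = 1/(4L²) + 1/a² + 1/b²`: the scaled bound `‖Q‖ ≤ κ²·qh`. -/
noncomputable def qh (L a b : ℝ) : ℝ := 1 / (4 * L ^ 2) + 1 / a ^ 2 + 1 / b ^ 2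
/-- `Th`: the scaled bound `‖T‖ ≤ κ·Th` on the three Taylor remainders. -/
noncomputable def Th (L a b t : ℝ) : ℝ := t ^ 2 / (4 * L ^ 2 * (2 * L - t)) + t ^ 2 / (a ^ 2 * (a - t)) + t ^ 2 / (b ^ 2 * (b - t))
/-- `Xh = qh·t + Th + M t/L²`: the scaled bound `‖X‖ ≤ κ·Xh`. -/
noncomputable def Xh (L a b t M : ℝ) : ℝ := qh L a b * t + Th L a b t + M * t / L ^ 2
/-- `0 ≤ qh`. -/
theorem qh_nonneg (L a b : ℝ) : 0 ≤ qh L a b := by unfold qh; positivity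
/-- `qh ≤ 1/72` under the floors `L ≥ 18`, `a ≥ 9`, `b ≥ 36`. -/
theorem qh_le {L a b : ℝ} (hL : 18 ≤ L) (ha : 9 ≤ a) (hb : 36 ≤ b) : qh L a b ≤ 1 / 72 := by
  have h1 : 1 / (4 * L ^ 2) ≤ 1 / 1296 := one_div_le_one_div_of_le (by norm_num) (by nlinarith)
  have h2 : 1 / a ^ 2 ≤ 1 / 81 := one_div_le_one_div_of_le (by norm_num) (by nlinarith)
  have h3 : 1 / b ^ 2 ≤ 1 / 1296 := one_div_le_one_div_of_le (by norm_num) (by nlinarith)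
  unfold qh; linarith
/-- one remainder piece `t²/(c(e−t))` is monotone in `t` and antitone in `c`, `e`. -/
theorem piece_le {c e t c₀ e₀ t₀ : ℝ} (hc : c₀ ≤ c) (hc₀ : 0 < c₀) (he : e₀ ≤ e) (ht0 : 0 ≤ t) (ht : t ≤ t₀) (he₀ : t₀ < e₀) :
    t ^ 2 / (c * (e - t)) ≤ t₀ ^ 2 / (c₀ * (e₀ - t₀)) := by
  obtain ⟨hc', h1, h2⟩ : 0 < c ∧ 0 < e₀ - t₀ ∧ 0 < e - t := ⟨lt_of_lt_of_le hc₀ hc, by linarith, by linarith⟩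
  calc t ^ 2 / (c * (e - t)) ≤ t₀ ^ 2 / (c * (e - t)) := div_le_div_of_nonneg_right (pow_le_pow_left₀ ht0 ht 2) (mul_pos hc' h2).le
    _ ≤ t₀ ^ 2 / (c₀ * (e₀ - t₀)) :=
        div_le_div_of_nonneg_left (by positivity) (mul_pos hc₀ h1) (mul_le_mul hc (by linarith) h1.le hc'.le)
/-- `0 ≤ Th` for `t < 9`. -/
theorem Th_nonneg {L a b t : ℝ} (hL : 18 ≤ L) (ha : 9 ≤ a) (hb : 36 ≤ b) (ht : t < 9) : 0 ≤ Th L a b t := by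
  obtain ⟨h1, h2, h3⟩ : 0 ≤ 2 * L - t ∧ 0 ≤ a - t ∧ 0 ≤ b - t := ⟨by linarith, by linarith, by linarith⟩
  unfold Th
  exact add_nonneg (add_nonneg (div_nonneg (sq_nonneg t) (mul_nonneg (by positivity) h1))
    (div_nonneg (sq_nonneg t) (mul_nonneg (sq_nonneg a) h2))) (div_nonneg (sq_nonneg t) (mul_nonneg (sq_nonneg b) h3))
/-- `Th` at `t ≤ t₀ < 9` under the floors. -/
theorem Th_le {L a b t t₀ : ℝ} (hL : 18 ≤ L) (ha : 9 ≤ a) (hb : 36 ≤ b) (ht0 : 0 ≤ t) (ht : t ≤ t₀) (ht₀ : t₀ < 9) :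
    Th L a b t ≤ t₀ ^ 2 / (1296 * (36 - t₀)) + t₀ ^ 2 / (81 * (9 - t₀)) + t₀ ^ 2 / (1296 * (36 - t₀)) := by
  have h1 := piece_le (c := 4 * L ^ 2) (e := 2 * L) (c₀ := 1296) (e₀ := 36) (by nlinarith) (by norm_num) (by linarith) ht0 ht (by linarith)
  have h2 := piece_le (c := a ^ 2) (e := a) (c₀ := 81) (e₀ := 9) (by nlinarith) (by norm_num) ha ht0 ht ht₀
  have h3 := piece_le (c := b ^ 2) (e := b) (c₀ := 1296) (e₀ := 36) (by nlinarith) (by norm_num) hb ht0 ht (by linarith)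
  unfold Th; linarith
/-- `Th ≤ (29/200)·qh` for `t ≤ 16/15` (`(16/15)²/(9 − 16/15) ≤ 29/200`). -/
theorem Th_le_qh {L a b t : ℝ} (hL : 18 ≤ L) (ha : 9 ≤ a) (hb : 36 ≤ b) (ht0 : 0 ≤ t) (ht : t ≤ 16 / 15) :
    Th L a b t ≤ 29 / 200 * qh L a b := by
  have g : ∀ {c e : ℝ}, 0 < c → 9 ≤ e → t ^ 2 / (c * (e - t)) ≤ 29 / 200 * (1 / c) := fun {c e} hc he => by
    rw [show 29 / 200 * (1 / c) = 29 / 200 / c by ring, div_le_div_iff₀ (mul_pos hc (by linarith)) hc]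
    nlinarith [mul_le_mul_of_nonneg_left (show t ^ 2 ≤ 29 / 200 * (e - t) by nlinarith) hc.le]
  have h1 := g (c := 4 * L ^ 2) (e := 2 * L) (by positivity) (by linarith)
  have h2 := g (c := a ^ 2) (e := a) (by positivity) ha
  have h3 := g (c := b ^ 2) (e := b) (by positivity) (by linarith)
  unfold Th qh; linarith
/-- `0 ≤ Xh` for `0 ≤ t < 9`, `0 ≤ M`. -/
theorem Xh_nonneg {L a b t M : ℝ} (hL : 18 ≤ L) (ha : 9 ≤ a) (hb : 36 ≤ b) (hM0 : 0 ≤ M) (ht0 : 0 ≤ t) (ht : t < 9) : 0 ≤ Xh L a b t M := by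
  have h1 := Th_nonneg hL ha hb ht; have h2 := qh_nonneg L a b; unfold Xh; positivity
/-- `Xh` at `t ≤ t₀ < 9`. -/
theorem Xh_le {L a b t M t₀ : ℝ} (hL : 18 ≤ L) (ha : 9 ≤ a) (hb : 36 ≤ b) (hM : M ≤ 10) (ht0 : 0 ≤ t) (ht : t ≤ t₀) (ht₀ : t₀ < 9) :
    Xh L a b t M ≤ t₀ / 72 + (t₀ ^ 2 / (1296 * (36 - t₀)) + t₀ ^ 2 / (81 * (9 - t₀)) + t₀ ^ 2 / (1296 * (36 - t₀))) + 10 * t₀ / 324 := by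
  have h1 : qh L a b * t ≤ 1 / 72 * t₀ := mul_le_mul (qh_le hL ha hb) ht ht0 (by norm_num)
  have h2 := Th_le hL ha hb ht0 ht ht₀
  have h3 : M * t / L ^ 2 ≤ 10 * t₀ / 324 := by
    rw [div_le_div_iff₀ (by positivity) (by norm_num)]
    exact mul_le_mul (mul_le_mul hM ht ht0 (by norm_num)) (by nlinarith) (by norm_num) (by linarith)
  unfold Xh; linarith
/-- two-round BOOTSTRAP of the a-priori radius: `t ≤ 3` and `t ≤ 1 + t·Xh(t)` give `t ≤ 16/15`. -/
theorem boot {L a b t M : ℝ} (hL : 18 ≤ L) (ha : 9 ≤ a) (hb : 36 ≤ b) (hM : M ≤ 10) (ht0 : 0 ≤ t) (ht3 : t ≤ 3)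
    (hboot : t ≤ 1 + t * Xh L a b t M) : t ≤ 16 / 15 := by
  have hX1 : Xh L a b t M ≤ 1 / 6 := (Xh_le hL ha hb hM ht0 ht3 (by norm_num)).trans (by norm_num)
  have ht65 : t ≤ 6 / 5 := by nlinarith [mul_le_mul_of_nonneg_left hX1 ht0]
  have hX2 : Xh L a b t M ≤ 1 / 16 := (Xh_le hL ha hb hM ht0 ht65 (by norm_num)).trans (by norm_num)
  nlinarith [mul_le_mul_of_nonneg_left hX2 ht0]
/-- TERM1, pole `w̄`: `L²·t·t²/(4L²(2L − t)) ≤ (4/25)/L`. -/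
theorem term1w {L t : ℝ} (hL : 18 ≤ L) (ht0 : 0 < t) (ht : t ≤ 16 / 15) : L ^ 2 * t * (t ^ 2 / (4 * L ^ 2 * (2 * L - t))) ≤ 4 / 25 * (1 / L) := by
  obtain ⟨h2L, hL0, ht3⟩ : 0 < 2 * L - t ∧ 0 < L ∧ t ^ 3 ≤ (16 / 15) ^ 3 := ⟨by linarith, by linarith, pow_le_pow_left₀ ht0.le ht 3⟩
  rw [show (4:ℝ) / 25 * (1 / L) = 4 / 25 / L by ring, ← mul_div_assoc, div_le_div_iff₀ (by positivity) hL0]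
  have key : L * t ^ 3 ≤ 4 / 25 * (4 * (2 * L - t)) := by nlinarith [mul_le_mul_of_nonneg_left ht3 hL0.le]
  nlinarith [mul_le_mul_of_nonneg_left key (sq_nonneg L)]
/-- TERM1, pole `p`: `L²·t·t²/(a²(a − t)) ≤ (7/5)·L²/a³`. -/
theorem term1a {L a t : ℝ} (ha : 9 ≤ a) (hL0 : 0 < L) (ht0 : 0 < t) (ht : t ≤ 16 / 15) : L ^ 2 * t * (t ^ 2 / (a ^ 2 * (a - t))) ≤ 7 / 5 * (L ^ 2 / a ^ 3) := by
  obtain ⟨hat, ha0, ht3⟩ : 0 < a - t ∧ 0 < a ∧ t ^ 3 ≤ (16 / 15) ^ 3 := ⟨by linarith, by linarith, pow_le_pow_left₀ ht0.le ht 3⟩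
  have ht3' : t ^ 3 ≤ 7 / 5 := ht3.trans (by norm_num)
  rw [← mul_div_assoc, ← mul_div_assoc, div_le_div_iff₀ (by positivity) (by positivity)]
  have key : t ^ 3 * a ≤ 7 / 5 * (a - t) := by nlinarith [mul_nonneg (sub_nonneg.2 ha) (sub_nonneg.2 ht3')]
  nlinarith [mul_le_mul_of_nonneg_left key (by positivity : (0:ℝ) ≤ L ^ 2 * a ^ 2)]
/-- TERM1, pole `p̄`: `L²·t·t²/(b²(b − t)) ≤ (13/10)/L` (uses `b ≥ L`, `b ≥ 36`). -/
theorem term1b {L b t : ℝ} (hL : 18 ≤ L) (hb : 36 ≤ b) (hbL : L ≤ b) (ht0 : 0 < t) (ht : t ≤ 16 / 15) :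
    L ^ 2 * t * (t ^ 2 / (b ^ 2 * (b - t))) ≤ 13 / 10 * (1 / L) := by
  obtain ⟨hbt, hL0, hb0, ht3⟩ : 0 < b - t ∧ 0 < L ∧ 0 < b ∧ t ^ 3 ≤ (16 / 15) ^ 3 := ⟨by linarith, by linarith, by linarith, pow_le_pow_left₀ ht0.le ht 3⟩
  rw [show (13:ℝ) / 10 * (1 / L) = 13 / 10 / L by ring, ← mul_div_assoc, div_le_div_iff₀ (by positivity) hL0]
  have h1 : L ^ 3 ≤ b ^ 3 := pow_le_pow_left₀ hL0.le hbL 3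
  have h2 : t * b ^ 2 ≤ 16 / 15 / 36 * b ^ 3 := by nlinarith [mul_nonneg (sq_nonneg b) (show (0:ℝ) ≤ 16 / 15 / 36 * b - t by linarith)]
  nlinarith [mul_le_mul_of_nonneg_left ht3 (pow_nonneg hL0.le 3), mul_le_mul_of_nonneg_left h1 (by norm_num : (0:ℝ) ≤ (16 / 15) ^ 3),
    pow_nonneg hb0.le 3]
/-- TERM2: `L²·t·(M t/L²) = M t² ≤ (256/225)·M`. -/
theorem term2 {L t M : ℝ} (hL0 : 0 < L) (hM0 : 0 ≤ M) (ht0 : 0 < t) (ht : t ≤ 16 / 15) : L ^ 2 * t * (M * t / L ^ 2) ≤ 256 / 225 * M := by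
  have ht2 : t ^ 2 ≤ (16 / 15) ^ 2 := pow_le_pow_left₀ ht0.le ht 2
  rw [show L ^ 2 * t * (M * t / L ^ 2) = M * t ^ 2 by field_simp]
  nlinarith [mul_le_mul_of_nonneg_left ht2 hM0]
/-- `L²·qh² ≤ (5/32)/L + (13/72)·L²/a³` (six expanded terms; `36a ≤ b²` from `b ≥ 36`, `b ≥ a`; a case split `2a ≤ L ∨ L ≤ 2a` for `1/(2a²)`). -/
theorem Lq2_le {L a b : ℝ} (hL : 18 ≤ L) (ha : 9 ≤ a) (hab : a ≤ b) (hb : 36 ≤ b) (hbL : L ≤ b) :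
    L ^ 2 * qh L a b ^ 2 ≤ 5 / 32 * (1 / L) + 13 / 72 * (L ^ 2 / a ^ 3) := by
  obtain ⟨hL0, ha0, hb0⟩ : 0 < L ∧ 0 < a ∧ 0 < b := ⟨by linarith, by linarith, by linarith⟩
  have e : L ^ 2 * qh L a b ^ 2 = 1 / (16 * L ^ 2) + L ^ 2 / a ^ 4 + L ^ 2 / b ^ 4 + 1 / (2 * a ^ 2) + 1 / (2 * b ^ 2) + 2 * L ^ 2 / (a ^ 2 * b ^ 2) := by
    unfold qh; field_simp; ring
  have h1 : 1 / (16 * L ^ 2) ≤ 1 / 288 * (1 / L) := by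
    rw [show (1:ℝ) / 288 * (1 / L) = 1 / 288 / L by ring, div_le_div_iff₀ (by positivity) hL0]; nlinarith
  have h2 : L ^ 2 / a ^ 4 ≤ 1 / 9 * (L ^ 2 / a ^ 3) := by
    rw [← mul_div_assoc, div_le_div_iff₀ (by positivity) (by positivity)]
    nlinarith [mul_nonneg (mul_nonneg (sq_nonneg L) (pow_nonneg ha0.le 3)) (sub_nonneg.2 ha)]
  have h3 : L ^ 2 / b ^ 4 ≤ 1 / 36 * (1 / L) := by
    rw [show (1:ℝ) / 36 * (1 / L) = 1 / 36 / L by ring, div_le_div_iff₀ (by positivity) hL0]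
    have i1 : L ^ 3 ≤ b ^ 3 := pow_le_pow_left₀ hL0.le hbL 3
    nlinarith [mul_nonneg (pow_nonneg hb0.le 3) (sub_nonneg.2 hb)]
  have h4 : 1 / (2 * a ^ 2) ≤ 1 / 72 * (L ^ 2 / a ^ 3) + 1 / 9 * (1 / L) := by
    obtain ⟨hA0, hB0⟩ : 0 ≤ 1 / 72 * (L ^ 2 / a ^ 3) ∧ 0 ≤ 1 / 9 * (1 / L) := ⟨by positivity, by positivity⟩
    rcases le_total (2 * a) L with hc | hc
    · have : 1 / (2 * a ^ 2) ≤ 1 / 72 * (L ^ 2 / a ^ 3) := by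
        rw [← mul_div_assoc, div_le_div_iff₀ (by positivity) (by positivity)]
        nlinarith [mul_nonneg (sq_nonneg a) (show (0:ℝ) ≤ L ^ 2 - 36 * a by nlinarith [mul_nonneg hL0.le (sub_nonneg.2 hL)])]
      linarith
    · have : 1 / (2 * a ^ 2) ≤ 1 / 9 * (1 / L) := by
        rw [show (1:ℝ) / 9 * (1 / L) = 1 / 9 / L by ring, div_le_div_iff₀ (by positivity) hL0]; nlinarith [mul_nonneg ha0.le (sub_nonneg.2 ha)]
      linarith
  have h5 : 1 / (2 * b ^ 2) ≤ 1 / 72 * (1 / L) := by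
    rw [show (1:ℝ) / 72 * (1 / L) = 1 / 72 / L by ring, div_le_div_iff₀ (by positivity) hL0]; nlinarith [mul_nonneg hb0.le (sub_nonneg.2 hb)]
  have h6 : 2 * L ^ 2 / (a ^ 2 * b ^ 2) ≤ 1 / 18 * (L ^ 2 / a ^ 3) := by
    rw [← mul_div_assoc, div_le_div_iff₀ (by positivity) (by positivity)]
    have i1 : (0:ℝ) ≤ b ^ 2 - 36 * a := by nlinarith [mul_nonneg hb0.le (sub_nonneg.2 hb)]
    nlinarith [mul_nonneg (mul_nonneg (sq_nonneg L) (sq_nonneg a)) i1]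
  rw [e]; linarith
/-- TERM3: `L²·qh·Xh·(2 + Xh)·t² ≤ (9/20)/L + (13/25)·L²/a³ + (7/200)·M` (via `L²Xh ≤ (727/600)L²qh + (16/15)M`, `Xh ≤ 13/250`, `Lq2_le`). -/
theorem term3 {L a b t M : ℝ} (hL : 18 ≤ L) (ha : 9 ≤ a) (hab : a ≤ b) (hb : 36 ≤ b) (hbL : L ≤ b) (hM0 : 0 ≤ M) (hM : M ≤ 10)
    (ht0 : 0 < t) (ht : t ≤ 16 / 15) :
    L ^ 2 * qh L a b * Xh L a b t M * (2 + Xh L a b t M) * t ^ 2 ≤ 9 / 20 * (1 / L) + 13 / 25 * (L ^ 2 / a ^ 3) + 7 / 200 * M := by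
  have prod_le3 {x y z x' y' z' : ℝ} (hx : 0 ≤ x) (hy : 0 ≤ y) (hz : 0 ≤ z) (hxx : x ≤ x') (hyy : y ≤ y') (hzz : z ≤ z') :
      x * y * z ≤ x' * y' * z' := mul_le_mul (mul_le_mul hxx hyy hy (hx.trans hxx)) hzz hz (mul_nonneg (hx.trans hxx) (hy.trans hyy))
  have hq0 := qh_nonneg L a b; have hq := qh_le hL ha hb; have hTh := Th_le_qh hL ha hb ht0.le ht
  obtain ⟨hL0, hX0⟩ : 0 < L ∧ 0 ≤ Xh L a b t M := ⟨by linarith, Xh_nonneg hL ha hb hM0 ht0.le (by linarith)⟩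
  have ht2 : t ^ 2 ≤ (16 / 15) ^ 2 := pow_le_pow_left₀ ht0.le ht 2
  have eM : L ^ 2 * (M * t / L ^ 2) = M * t := by field_simp
  have hLX : L ^ 2 * Xh L a b t M ≤ 727 / 600 * (L ^ 2 * qh L a b) + 16 / 15 * M := by
    have i1 : L ^ 2 * (qh L a b * t) ≤ L ^ 2 * (qh L a b * (16 / 15)) := mul_le_mul_of_nonneg_left (mul_le_mul_of_nonneg_left ht hq0) (sq_nonneg L)
    have i2 : L ^ 2 * Th L a b t ≤ L ^ 2 * (29 / 200 * qh L a b) := mul_le_mul_of_nonneg_left hTh (sq_nonneg L)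
    have i3 : M * t ≤ M * (16 / 15) := mul_le_mul_of_nonneg_left ht hM0
    unfold Xh; rw [mul_add, mul_add, eM]; nlinarith
  have hX : Xh L a b t M ≤ 13 / 250 := by
    have i1 : qh L a b * t ≤ 1 / 72 * (16 / 15) := mul_le_mul hq ht ht0.le (by norm_num)
    have i3 : M * t / L ^ 2 ≤ 10 * (16 / 15) / 324 := by
      rw [div_le_div_iff₀ (by positivity) (by norm_num)]
      exact mul_le_mul (mul_le_mul hM ht ht0.le (by norm_num)) (by nlinarith) (by norm_num) (by positivity)
    have i2 : Th L a b t ≤ 29 / 200 * (1 / 72) := hTh.trans (by nlinarith)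
    unfold Xh; nlinarith
  rw [show L ^ 2 * qh L a b * Xh L a b t M * (2 + Xh L a b t M) * t ^ 2 = (L ^ 2 * Xh L a b t M) * qh L a b * (2 + Xh L a b t M) * t ^ 2 by ring]
  refine (prod_le3 (mul_nonneg (mul_nonneg (sq_nonneg L) hX0) hq0) (by linarith) (sq_nonneg t) (mul_le_mul_of_nonneg_right hLX hq0)
    (show 2 + Xh L a b t M ≤ 513 / 250 by linarith) ht2).trans ?_
  have hLq := Lq2_le hL ha hab hb hbL
  have hqM : M * qh L a b ≤ M * (1 / 72) := mul_le_mul_of_nonneg_left hq hM0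
  obtain ⟨hA0, hL1⟩ : 0 ≤ L ^ 2 / a ^ 3 ∧ 0 ≤ 1 / L := ⟨by positivity, by positivity⟩
  linarith [mul_nonneg hM0 hq0]
/-- THE KERNEL: with the bootstrap radius `t ≤ 16/15`, the scaled error is within budget `(9/5)M + 2/L + 2L²/a³`. -/
theorem kernel {L a b t M : ℝ} (hL : 18 ≤ L) (ha : 9 ≤ a) (hab : a ≤ b) (hbL : L + 18 ≤ b) (hM0 : 0 ≤ M) (hM : M ≤ 10)
    (ht0 : 0 < t) (ht : t ≤ 16 / 15) :
    L ^ 2 * (t * (Th L a b t + M * t / L ^ 2) + qh L a b * Xh L a b t M * (2 + Xh L a b t M) * t ^ 2) ≤ 9 / 5 * M + 2 / L + 2 * L ^ 2 / a ^ 3 := by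
  obtain ⟨hb, hbL', hL0⟩ : 36 ≤ b ∧ L ≤ b ∧ 0 < L := ⟨by linarith, by linarith, by linarith⟩
  rw [show L ^ 2 * (t * (Th L a b t + M * t / L ^ 2) + qh L a b * Xh L a b t M * (2 + Xh L a b t M) * t ^ 2)
      = L ^ 2 * t * (t ^ 2 / (4 * L ^ 2 * (2 * L - t))) + L ^ 2 * t * (t ^ 2 / (a ^ 2 * (a - t))) + L ^ 2 * t * (t ^ 2 / (b ^ 2 * (b - t)))
        + L ^ 2 * t * (M * t / L ^ 2) + L ^ 2 * qh L a b * Xh L a b t M * (2 + Xh L a b t M) * t ^ 2 by unfold Th; ring,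
    show 2 * L ^ 2 / a ^ 3 = 2 * (L ^ 2 / a ^ 3) by ring, show (2:ℝ) / L = 2 * (1 / L) by ring]
  have h1 := term1w hL ht0 ht
  have h2 := term1a ha hL0 ht0 ht
  have h3 := term1b hL hb hbL' ht0 ht
  have h4 := term2 hL0 hM0 ht0 ht
  have h5 := term3 hL ha hab hb hbL' hM0 hM ht0 ht
  obtain ⟨hA0, hL1⟩ : 0 ≤ L ^ 2 / a ^ 3 ∧ 0 ≤ 1 / L := ⟨by positivity, by positivity⟩
  linarith

/-! ## §2  Complex algebra: Taylor remainders, the `K + X = −d⁻¹` bookkeeping, the key identity -/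
/-- second-order Taylor expansion of `(δ + d)⁻¹` with its exact remainder. -/
theorem inv_add_eq (δ d : ℂ) (hδ : δ ≠ 0) (hδd : δ + d ≠ 0) : (δ + d)⁻¹ = δ⁻¹ - δ⁻¹ ^ 2 * d + d ^ 2 / (δ ^ 2 * (δ + d)) := by
  field_simp; ring
/-- `‖d‖ < ‖δ‖` forces `δ ≠ 0` and `δ + d ≠ 0`. -/
theorem ne_zero_of_norm_lt (δ d : ℂ) (h : ‖d‖ < ‖δ‖) : δ ≠ 0 ∧ δ + d ≠ 0 := by
  refine ⟨norm_pos_iff.1 (lt_of_le_of_lt (norm_nonneg d) h), fun h0 => ?_⟩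
  have h1 := norm_sub_le_norm_add δ d
  rw [h0, norm_zero] at h1; linarith
/-- norm of the remainder: `‖d²/(δ²(δ+d))‖ ≤ ‖d‖²/(‖δ‖²(‖δ‖ − ‖d‖))` for `‖d‖ < ‖δ‖`. -/
theorem norm_rem_le (δ d : ℂ) (h : ‖d‖ < ‖δ‖) : ‖d ^ 2 / (δ ^ 2 * (δ + d))‖ ≤ ‖d‖ ^ 2 / (‖δ‖ ^ 2 * (‖δ‖ - ‖d‖)) := by
  obtain ⟨h0, hδ⟩ : 0 < ‖δ‖ - ‖d‖ ∧ 0 < ‖δ‖ := ⟨by linarith, lt_of_le_of_lt (norm_nonneg d) h⟩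
  rw [norm_div, norm_mul, norm_pow, norm_pow]
  exact div_le_div_of_nonneg_left (by positivity) (mul_pos (by positivity) h0)
    (mul_le_mul_of_nonneg_left (norm_sub_le_norm_add δ d) (by positivity))
/-- the KEY IDENTITY: with `K + X = −d⁻¹`, `d + K⁻¹ + Q K⁻³ = −(X − Q d)·d/K + Q·X·(2K + X)·d²/K³`. -/
theorem key_identity (d K Q X : ℂ) (hd : d ≠ 0) (hK : K ≠ 0) (hX : K + X = -d⁻¹) :
    d + K⁻¹ + Q * K⁻¹ ^ 3 = -(X - Q * d) * d / K + Q * X * (2 * K + X) * d ^ 2 / K ^ 3 := by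
  have hX' : X = -d⁻¹ - K := by linear_combination hX
  subst hX'; field_simp; ring
/-- norm form of the key identity. -/
theorem norm_key_le (d K Q X : ℂ) (hd : d ≠ 0) (hK : K ≠ 0) (hX : K + X = -d⁻¹) :
    ‖d + K⁻¹ + Q * K⁻¹ ^ 3‖ ≤ ‖X - Q * d‖ * ‖d‖ / ‖K‖ + ‖Q‖ * ‖X‖ * (2 * ‖K‖ + ‖X‖) * ‖d‖ ^ 2 / ‖K‖ ^ 3 := by
  rw [key_identity d K Q X hd hK hX]
  have h2 : ‖2 * K + X‖ ≤ 2 * ‖K‖ + ‖X‖ := (norm_add_le _ _).trans (by rw [norm_mul, Complex.norm_two])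
  calc ‖-(X - Q * d) * d / K + Q * X * (2 * K + X) * d ^ 2 / K ^ 3‖ ≤ ‖-(X - Q * d) * d / K‖ + ‖Q * X * (2 * K + X) * d ^ 2 / K ^ 3‖ := norm_add_le _ _
    _ = ‖X - Q * d‖ * ‖d‖ / ‖K‖ + ‖Q‖ * ‖X‖ * ‖2 * K + X‖ * ‖d‖ ^ 2 / ‖K‖ ^ 3 := by simp only [norm_div, norm_mul, norm_neg, norm_pow]
    _ ≤ ‖X - Q * d‖ * ‖d‖ / ‖K‖ + ‖Q‖ * ‖X‖ * (2 * ‖K‖ + ‖X‖) * ‖d‖ ^ 2 / ‖K‖ ^ 3 := by gcongr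
/-- bookkeeping: with the three Taylor expansions, `K + (Q d + T − E) = −d⁻¹`. -/
theorem K_add_X (d δ₁ δ₂ δ₃ R K Q E : ℂ) (h1 : δ₁ ≠ 0) (h1' : δ₁ + d ≠ 0) (h2 : δ₂ ≠ 0) (h2' : δ₂ + d ≠ 0) (h3 : δ₃ ≠ 0) (h3' : δ₃ + d ≠ 0)
    (hK : K = δ₁⁻¹ + δ₂⁻¹ + δ₃⁻¹ + R) (hQ : Q = -(δ₁⁻¹ ^ 2 + δ₂⁻¹ ^ 2 + δ₃⁻¹ ^ 2))
    (hE : E = d⁻¹ + (δ₁ + d)⁻¹ + (δ₂ + d)⁻¹ + (δ₃ + d)⁻¹ + R) :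
    K + (Q * d + (d ^ 2 / (δ₁ ^ 2 * (δ₁ + d)) + d ^ 2 / (δ₂ ^ 2 * (δ₂ + d)) + d ^ 2 / (δ₃ ^ 2 * (δ₃ + d))) - E) = -d⁻¹ := by
  rw [hK, hQ, hE, inv_add_eq δ₁ d h1 h1', inv_add_eq δ₂ d h2 h2', inv_add_eq δ₃ d h3 h3']; ring

/-! ## §3  Geometry of the configuration -/
/-- `‖w − w̄‖ = 2 Im w`. -/
theorem norm_sub_conj_eq (w : ℂ) (hw : 0 < w.im) : ‖w - conj w‖ = 2 * w.im := by
  rw [Complex.sub_conj, norm_mul, Complex.norm_I, mul_one, Complex.norm_of_nonneg (by linarith)]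
/-- `Im w + Im p ≤ ‖w − p̄‖`. -/
theorem im_add_im_le_norm_sub_conj (w p : ℂ) (hw : 0 < w.im) (hp : 0 < p.im) : w.im + p.im ≤ ‖w - conj p‖ := by
  have h1 := Complex.abs_im_le_norm (w - conj p)
  rw [Complex.sub_im, Complex.conj_im, sub_neg_eq_add] at h1
  rwa [abs_of_pos (by linarith)] at h1
/-- `‖w − p‖ ≤ ‖w − p̄‖` in the upper half-plane. -/
theorem norm_sub_le_norm_sub_conj (w p : ℂ) (hw : 0 < w.im) (hp : 0 < p.im) : ‖w - p‖ ≤ ‖w - conj p‖ := by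
  have hsq : ‖w - p‖ ^ 2 ≤ ‖w - conj p‖ ^ 2 := by
    rw [Complex.sq_norm, Complex.sq_norm, Complex.normSq_apply, Complex.normSq_apply]
    simp only [Complex.sub_re, Complex.sub_im, Complex.conj_re, Complex.conj_im]
    nlinarith [mul_pos hw hp]
  have := abs_le_of_sq_le_sq hsq (norm_nonneg _)
  rwa [abs_of_nonneg (norm_nonneg _)] at this

/-! ## §4  From norms to the kernel, and the location lemma -/
/-- RAW KERNEL: the real plumbing.  Inputs: the norm bounds of the main proof (`nT = ‖T‖`, `nE = ‖E‖`, `nQ = ‖Q‖`, `nX = ‖X‖`, `nXQ = ‖X − Q d‖`,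
`err = ‖d + K⁻¹ + Q K⁻³‖`, `n = ‖d‖`, `κ = ‖K‖`), the scaled variables `L = Im w·κ`, `a = ‖w−p‖κ`, `b = ‖w−p̄‖κ`,
`t = ‖d‖κ`, and the bootstrap
inequality `κ ≤ 1/‖d‖ + ‖X‖`; output: the target radius. -/
theorem kernel_raw {κ h r n M L a b t nT nE nQ nX nXQ err : ℝ} (hκ : 0 < κ) (hh : 0 < h) (hr : 0 < r) (hn : 0 < n)
    (hLe : L = h * κ) (hae : a = r * κ) (hte : t = n * κ) (hL : 18 ≤ L) (ha : 9 ≤ a) (hab : a ≤ b) (hbL : L + 18 ≤ b)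
    (hM0 : 0 ≤ M) (hM : M ≤ 10) (ht3 : t ≤ 3) (hT : nT ≤ κ * Th L a b t) (hE : nE ≤ κ * (M * t / L ^ 2)) (hQ : nQ ≤ κ ^ 2 * qh L a b)
    (hX : nX ≤ nQ * n + nT + nE) (hXQ : nXQ ≤ nT + nE) (hnQ : 0 ≤ nQ) (hnX : 0 ≤ nX) (hboot : κ ≤ n⁻¹ + nX)
    (herr : err ≤ nXQ * n / κ + nQ * nX * (2 * κ + nX) * n ^ 2 / κ ^ 3) :
    err ≤ (9 / 5 * M + 2 * ((1 + (h / r) ^ 3) / (h * κ))) / (h * κ) ^ 2 / κ := by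
  have prod_le3 {x y z x' y' z' : ℝ} (hx : 0 ≤ x) (hy : 0 ≤ y) (hz : 0 ≤ z) (hxx : x ≤ x') (hyy : y ≤ y') (hzz : z ≤ z') :
      x * y * z ≤ x' * y' * z' := mul_le_mul (mul_le_mul hxx hyy hy (hx.trans hxx)) hzz hz (mul_nonneg (hx.trans hxx) (hy.trans hyy))
  obtain ⟨hL0, hb36, ht0, hq0⟩ : 0 < L ∧ 36 ≤ b ∧ 0 < t ∧ 0 ≤ qh L a b := ⟨by linarith, by linarith, by rw [hte]; exact mul_pos hn hκ, qh_nonneg L a b⟩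
  have hXh : nX ≤ κ * Xh L a b t M := by
    have h1 := mul_le_mul_of_nonneg_right hQ hn.le
    unfold Xh; rw [mul_add, mul_add, ← show κ ^ 2 * qh L a b * n = κ * (qh L a b * t) by rw [hte]; ring]; linarith
  have hboot' : t ≤ 1 + t * Xh L a b t M := by
    have h2 := mul_le_mul_of_nonneg_left hboot hn.le
    rw [mul_add, mul_inv_cancel₀ hn.ne'] at h2
    have e1 : n * (κ * Xh L a b t M) = t * Xh L a b t M := by rw [hte]; ring
    linarith [mul_le_mul_of_nonneg_left hXh hn.le]
  have ht16 := boot hL ha hb36 hM ht0.le ht3 hboot'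
  have hXh0 := Xh_nonneg hL ha hb36 hM0 ht0.le (by linarith)
  have hTE : nXQ ≤ κ * (Th L a b t + M * t / L ^ 2) := by rw [mul_add]; linarith
  have hB : err ≤ (κ * (Th L a b t + M * t / L ^ 2)) * n / κ + (κ ^ 2 * qh L a b) * (κ * Xh L a b t M) * (2 * κ + κ * Xh L a b t M) * n ^ 2 / κ ^ 3 :=
    herr.trans (add_le_add (div_le_div_of_nonneg_right (mul_le_mul_of_nonneg_right hTE hn.le) hκ.le) (div_le_div_of_nonneg_right
      (mul_le_mul_of_nonneg_right (prod_le3 hnQ hnX (by positivity) hQ hXh (by linarith)) (sq_nonneg n)) (pow_nonneg hκ.le 3)))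
  have hκ0 := hκ.ne'; have hL0' := hL0.ne'; have hh0 := hh.ne'; have hr0 := hr.ne'
  have eB : (κ * (Th L a b t + M * t / L ^ 2)) * n / κ + (κ ^ 2 * qh L a b) * (κ * Xh L a b t M) * (2 * κ + κ * Xh L a b t M) * n ^ 2 / κ ^ 3
      = L ^ 2 * (t * (Th L a b t + M * t / L ^ 2) + qh L a b * Xh L a b t M * (2 + Xh L a b t M) * t ^ 2) / (L ^ 2 * κ) := by
    rw [hte]; field_simp
  have ebud : (9 / 5 * M + 2 / L + 2 * L ^ 2 / a ^ 3) / (L ^ 2 * κ) = (9 / 5 * M + 2 * ((1 + (h / r) ^ 3) / (h * κ))) / (h * κ) ^ 2 / κ := by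
    rw [hLe, hae]; field_simp; ring
  calc err ≤ _ := hB
    _ = _ := eB
    _ ≤ (9 / 5 * M + 2 / L + 2 * L ^ 2 / a ^ 3) / (L ^ 2 * κ) := div_le_div_of_nonneg_right (kernel hL ha hab hbL hM0 hM ht0 ht16) (by positivity)
    _ = _ := ebud
/-- **L1 OF RECORD** (the WANTED v3 target, director (CA856)(2)/(CA859)(3)): `PairExactLocationQ 18 (9/5) 2`. -/
theorem pairExactLocationQ_18 : PairExactLocationQ 18 (9 / 5) 2 := by
  intro u w p R K Q M hw hp hsep hK hQ hfl hM0 hM10 hu hdisc himp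
  have hκ : 0 < ‖K‖ := by
    rcases (norm_nonneg K).lt_or_eq with h | h
    · exact h
    · rw [← h, mul_zero] at hfl; norm_num at hfl
  have hK0 : K ≠ 0 := norm_pos_iff.1 hκ
  have hδ₁n : ‖w - conj w‖ = 2 * w.im := norm_sub_conj_eq w hw
  have hS : w.im + p.im ≤ ‖w - conj p‖ := im_add_im_le_norm_sub_conj w p hw hp
  have hrS : ‖w - p‖ ≤ ‖w - conj p‖ := norm_sub_le_norm_sub_conj w p hw hp
  obtain ⟨hm0, hmh, hmη⟩ : 0 < min w.im p.im ∧ min w.im p.im ≤ w.im ∧ min w.im p.im ≤ p.im := ⟨lt_min hw hp, min_le_left _ _, min_le_right _ _⟩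
  have hr0 : 0 < ‖w - p‖ := by linarith
  have i1 := mul_le_mul_of_nonneg_right hsep hκ.le
  have i2 := mul_le_mul_of_nonneg_right hS hκ.le
  obtain ⟨hL, he⟩ : 18 ≤ w.im * ‖K‖ ∧ 18 ≤ p.im * ‖K‖ :=
    ⟨hfl.trans (mul_le_mul_of_nonneg_right hmh hκ.le), hfl.trans (mul_le_mul_of_nonneg_right hmη hκ.le)⟩
  obtain ⟨ha9, hbL⟩ : 9 ≤ ‖w - p‖ * ‖K‖ ∧ w.im * ‖K‖ + 18 ≤ ‖w - conj p‖ * ‖K‖ := ⟨by linarith, by linarith⟩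
  have hab : ‖w - p‖ * ‖K‖ ≤ ‖w - conj p‖ * ‖K‖ := mul_le_mul_of_nonneg_right hrS hκ.le
  -- the displacement `d = u − w`: `‖d‖ ≤ 3/κ ≤ min/6`, so every pole stays away
  have hd0 : u - w ≠ 0 := sub_ne_zero.2 hu
  have hn : 0 < ‖u - w‖ := norm_pos_iff.2 hd0
  have hn6 : ‖u - w‖ ≤ min w.im p.im / 6 := hdisc.trans (by rw [div_le_div_iff₀ hκ (by norm_num)]; linarith)
  have ht3 : ‖u - w‖ * ‖K‖ ≤ 3 := (le_div_iff₀ hκ).1 hdisc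
  obtain ⟨hlt1, hlt2, hlt3⟩ : ‖u - w‖ < ‖w - conj w‖ ∧ ‖u - w‖ < ‖w - p‖ ∧ ‖u - w‖ < ‖w - conj p‖ :=
    ⟨by rw [hδ₁n]; linarith, by linarith, by linarith⟩
  obtain ⟨hne1, hne1'⟩ := ne_zero_of_norm_lt _ _ hlt1
  obtain ⟨hne2, hne2'⟩ := ne_zero_of_norm_lt _ _ hlt2
  obtain ⟨hne3, hne3'⟩ := ne_zero_of_norm_lt _ _ hlt3
  -- rewrite the implicit clause and the goal through `d`, name the objects
  rw [show u - conj w = (w - conj w) + (u - w) by ring, show u - p = (w - p) + (u - w) by ring,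
    show u - conj p = (w - conj p) + (u - w) by ring] at himp
  rw [show u - (w - K⁻¹ - Q * K⁻¹ ^ 3) = (u - w) + K⁻¹ + Q * K⁻¹ ^ 3 by ring]
  set d := u - w; set δ₁ := w - conj w; set δ₂ := w - p; set δ₃ := w - conj p
  set E := d⁻¹ + (δ₁ + d)⁻¹ + (δ₂ + d)⁻¹ + (δ₃ + d)⁻¹ + R with hEdef
  set T := d ^ 2 / (δ₁ ^ 2 * (δ₁ + d)) + d ^ 2 / (δ₂ ^ 2 * (δ₂ + d)) + d ^ 2 / (δ₃ ^ 2 * (δ₃ + d)) with hTdef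
  set X := Q * d + T - E with hXdef
  have hKX : K + X = -d⁻¹ := by rw [hXdef, hTdef]; exact K_add_X d δ₁ δ₂ δ₃ R K Q E hne1 hne1' hne2 hne2' hne3 hne3' hK hQ hEdef
  have herr := norm_key_le d K Q X hd0 hK0 hKX
  have hT : ‖T‖ ≤ ‖d‖ ^ 2 / (‖δ₁‖ ^ 2 * (‖δ₁‖ - ‖d‖)) + ‖d‖ ^ 2 / (‖δ₂‖ ^ 2 * (‖δ₂‖ - ‖d‖))
      + ‖d‖ ^ 2 / (‖δ₃‖ ^ 2 * (‖δ₃‖ - ‖d‖)) := by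
    rw [hTdef]
    exact (norm_add_le _ _).trans (add_le_add ((norm_add_le _ _).trans (add_le_add (norm_rem_le δ₁ d hlt1) (norm_rem_le δ₂ d hlt2)))
      (norm_rem_le δ₃ d hlt3))
  have hQn : ‖Q‖ ≤ 1 / ‖δ₁‖ ^ 2 + 1 / ‖δ₂‖ ^ 2 + 1 / ‖δ₃‖ ^ 2 := by
    rw [hQ, norm_neg]
    refine (norm_add_le _ _).trans (add_le_add ((norm_add_le _ _).trans (add_le_add ?_ ?_)) ?_) <;> rw [norm_pow, norm_inv, inv_pow, one_div]
  have hX1 : ‖X‖ ≤ ‖Q‖ * ‖d‖ + ‖T‖ + ‖E‖ := by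
    rw [hXdef]; exact (norm_sub_le _ _).trans (add_le_add ((norm_add_le _ _).trans (by rw [norm_mul])) le_rfl)
  have hXQ : ‖X - Q * d‖ ≤ ‖T‖ + ‖E‖ := by rw [show X - Q * d = T - E by rw [hXdef]; ring]; exact norm_sub_le _ _
  have hboot1 : ‖K‖ ≤ ‖d‖⁻¹ + ‖X‖ := by
    rw [show K = -d⁻¹ - X by linear_combination hKX]; exact (norm_sub_le _ _).trans (by rw [norm_neg, norm_inv])
  -- scaling identities (`L = Im w·κ`, `a = ‖δ₂‖κ`, `b = ‖δ₃‖κ`, `t = ‖d‖κ`) and the raw kernel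
  obtain ⟨hS0, hs1, hs2, hs3⟩ : 0 < ‖δ₃‖ ∧ 0 < 2 * w.im - ‖d‖ ∧ 0 < ‖δ₂‖ - ‖d‖ ∧ 0 < ‖δ₃‖ - ‖d‖ :=
    ⟨by linarith [norm_nonneg d], by linarith, by linarith, by linarith⟩
  have hκ0 := hκ.ne'; have hw0 := hw.ne'; have hr0' := hr0.ne'; have hS0' := hS0.ne'; have hs1' := hs1.ne'; have hs2' := hs2.ne'; have hs3' := hs3.ne'
  have eQ : 1 / ‖δ₁‖ ^ 2 + 1 / ‖δ₂‖ ^ 2 + 1 / ‖δ₃‖ ^ 2 = ‖K‖ ^ 2 * qh (w.im * ‖K‖) (‖δ₂‖ * ‖K‖) (‖δ₃‖ * ‖K‖) := by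
    rw [hδ₁n]; unfold qh; field_simp; ring
  have eT : ‖d‖ ^ 2 / (‖δ₁‖ ^ 2 * (‖δ₁‖ - ‖d‖)) + ‖d‖ ^ 2 / (‖δ₂‖ ^ 2 * (‖δ₂‖ - ‖d‖))
      + ‖d‖ ^ 2 / (‖δ₃‖ ^ 2 * (‖δ₃‖ - ‖d‖))
      = ‖K‖ * Th (w.im * ‖K‖) (‖δ₂‖ * ‖K‖) (‖δ₃‖ * ‖K‖) (‖d‖ * ‖K‖) := by
    rw [hδ₁n]; unfold Th
    rw [show 2 * (w.im * ‖K‖) - ‖d‖ * ‖K‖ = (2 * w.im - ‖d‖) * ‖K‖ by ring,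
      show ‖δ₂‖ * ‖K‖ - ‖d‖ * ‖K‖ = (‖δ₂‖ - ‖d‖) * ‖K‖ by ring,
      show ‖δ₃‖ * ‖K‖ - ‖d‖ * ‖K‖ = (‖δ₃‖ - ‖d‖) * ‖K‖ by ring]
    field_simp; ring
  have eE : M * ‖d‖ / w.im ^ 2 = ‖K‖ * (M * (‖d‖ * ‖K‖) / (w.im * ‖K‖) ^ 2) := by field_simp
  exact kernel_raw (L := w.im * ‖K‖) (a := ‖δ₂‖ * ‖K‖) (b := ‖δ₃‖ * ‖K‖) (t := ‖d‖ * ‖K‖) hκ hw hr0 hn rfl rfl rfl hL ha9 hab hbL hM0 hM10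
    ht3 (hT.trans eT.le) (himp.trans eE.le) (hQn.trans eQ.le) hX1 hXQ (norm_nonneg Q) (norm_nonneg X) hboot1 herr
/-- the WANTED target instance: `PairExactLocationTarget`. -/
theorem pairExactLocationTarget : PairExactLocationTarget := pairExactLocationQ_18
/-- any larger floor / weaker constants follow (by-name surface for the budget). -/
theorem pairExactLocationQ_of_le {lam0 c₁ c₂ : ℝ} (h0 : 18 ≤ lam0) (h1 : 9 / 5 ≤ c₁) (h2 : 2 ≤ c₂) : PairExactLocationQ lam0 c₁ c₂ :=
  pairExactLocationQ_mono h0 h1 h2 pairExactLocationQ_18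

end RhW08.PairExactLocation
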